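/-
Origin: expansion seat `planner-pub-hodgecm-pv08-g4-0`, handover #1 2026-08-18T06:19:52Z (`HOME/pub-hodgecm-pv08-g4/lean/Pv08g4/S5QautFock.lean`, md5 d2fc2b24, 522 lines);
landed by the gen-6 packager in gate run 24 as `HodgeCM/PerL34/S5QautFock.lean` (verbatim).
-/
/-
Origin: HOME/pub-hodgecm-pv08-g4/lean/Pv08g4/S5QautFock.lean — session planner-pub-hodgecm-pv08-g4-0 (unit
pub-hodgecm-pv08-g4, DAG-NODE PROVER #08 gen 4; successor of pv08 / pv08-g2 / pv08-g3).  LEMMAS.md v10 §9 **seam S5**,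
`N19g` / (34)-half ("BRIDGE missing: `T.SK V c` / `D.ϑ` / `T.Λ` := the lattice model's Schwartz space, torus period and
cup pairing (D4) and the (1,0)-part ↔ Fock dictionary (D5)").  Intended final place: `HodgeCM/PerL34/S5QautFock.lean`,
after the LANDED `HodgeCM/PerL34/QautDictionary.lean` (pv02-g2, run 22), `HodgeCM/PerL34/P43_KTypesFockJplus.lean`
(pv14-g3, run 23) and `HodgeCM/PerL34/S5ConservativeQaut.lean` (pv08-g2, run 22); imports `HodgeCM.*` only, no
rewrite needed.  New namespace `HodgeCM.PerL34.QautFock`.  Asserts nothing: no axiom, no placeholder proof; every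
field of the record is labelled SHELL / DEFINITIONAL / DICTIONARY below; nothing is cited as a fact.
-/
import Summits.HodgeConjecture.HodgeCM.PerL34.QautDictionary
import Summits.HodgeConjecture.HodgeCM.PerL34.P43_KTypesFockJplus
import Summits.HodgeConjecture.HodgeCM.PerL34.S5ConservativeQaut_2

/-!
# Seam S5, `N19g` half, SHARPENED: the `K`-type bookkeeping of Lemma 3.5 is KERNEL over pv12/pv14's explicit Fock model

## What the landed S5 record leaves inside one dictionary field

pv02-g2's `QautDictionary.QautBridge T V c D k l` (run 22) derives pv08's leaf `S12Wedges.N19g_core` (the finite-sum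
core of PerL v5 Lemma 3.5 `lem:S12`, tex ll. 356–372, for the side `(k,l)` with torus data `D`) from a record whose
one composite field `decomp` (QautDictionary.lean :170) bundles FOUR sentences of the tex:
  (i)   (eq:seesaw) on pure tensors, l. 362: `ϑ_{T,χ}(pr_κ(φ₁ ⊗ φ₂)) = pr_κ(θ(φ₁,χ'₁) θ(φ₂,χ'₂))`        [DICTIONARY, N17];
  (ii)  `K`-type transport, l. 362–363: "`θ(φ_j,χ'_j) ∈ π_j` has the `K_∞`-type of `φ_j`"                  [DICTIONARY, D4];
  (iii) the `K_{ι₁}`-type LIST of `J⁺`, l. 364–366: "`Sym^n(V⁺) ⊗ (V⁻)^{⊗−n}`, `n ≥ 1`, each once — in the Fock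
        model … the `χ̄'_{ι₁}`-isotypic part is spanned by `{z^a w^e : |a| = e+1}`, of `K_V`-weights `(a; −1−e)`"
        — typed as `1 ≤ w₁ i ∧ σ k₀ (f₁ i) = ξ ^ (w₁ i) • f₁ i`                                             [PRINT];
  (iv)  l. 370–372: "`n₁ = n₂ = 1`, i.e. … both factors lie in the lowest `K_∞`-type `𝔭₊` … so they are components
        of holomorphic `1`-forms" — typed as `w₁ i = 1 → f₁ i ∈ span {u x | u ∈ Forms₁ χ}`               [PRINT-DERIVED].
pv08-g2's `S5ConservativeQaut.nonempty_qautBridge_iff` (run 22) shows that record is CONSERVATIVE over the leaf.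

## What this file does

It replaces `decomp` by the verbatim sentence (i)+(ii) ALONE, stated over pv14-g3's explicit `K_{ι₁} = U(2) × U(1)`
representation `Jplus` on the `J⁺`-piece `jplusSubmodule = {f ∈ ℂ[z₁,z₂,w] | U(1)_W-weight 1}` of pv12's Fock model
(`FockKTypes`, `P43_KTypesFock`, `P43_KTypesFockJplus`, runs 20/23), and DERIVES (iii) and (iv) in the kernel:

* `QautFockBridge T V c D k l` (§3) — the same archimedean shell as `QautBridge` (`K`, Haar `μ`, Banach algebra `C`,
  `σ`), plus
  - `κ : K →* U(2) × U(1)` [DICTIONARY D2: the projection `K_∞ → K_{ι₁}`; `𝔭₊ := pPlusMat ∘ κ` is then DEFINED —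
    `pPlusMat (A,d) = d̄ • A` (§1) is pv14-g3's `pPlus` as a matrix — not posited], with a torus element of distinct
    `𝔭₊`-weights and a Weyl element in its image (`ρ_diag`, `ρ_antidiag`: `K_{ι₁}` is a direct factor of `K_∞`) and the
    central element `k₀ ↦ (1₂, d₀)`, `d₀ ∈ U(1)` of infinite order;
  - `Ψ₁ χ, Ψ₂ χ : Set (jplusSubmodule →ₗ[ℂ] C)` — the THETA MAPS of the two sides at the character `χ = χ'₁ ⊠ χ'₂`:
    `p ↦ θ(p ⊗ φ^{ι₁,c}, χ'_j)` for fixed data `φ^{ι₁,c}` away from `ι₁` [DEFINITIONAL D4], each `K`-EQUIVARIANT: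
    `σ x (ψ p) = ψ (Jplus (κ x) p)` [DICTIONARY D4/D5: (ii) — `ω(k)` commutes with `θ(·,χ')` and `K_{ι₁}` acts on the
    `ι₁`-component through the Fock model; that `p` ranges over the `J⁺`-piece is Lemma 4.1(a)/N26: only the
    `χ̄'_{ι₁}`-isotypic part of `φ_{ι₁}` contributes];
  - `wedge_mem` [DICTIONARY D2 + (Qaut) §3.1 + Lemma 3.3(a), l. 371–372 / ll. 655–657]: the wedge of the CANONICAL
    one-forms `formOf ψ : x ↦ ψ (x₁ z₁ + x₂ z₂)` (§2; the harmonic plane `𝔭₊ ↪ J⁺`, pv14-g3 `zLin`) of two theta maps of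
    an allowed `χ` is a `(k,l)`-wedge-function of the model;
  - `seesawPure` [DICTIONARY, (i): (eq:seesaw) on the dense set `P = pr_κ(𝒫)` of finite sums of pure tensors with
    Fock-polynomial archimedean components, l. 360–362]:
    `D.ϑ χ Φ = toHG (∑ i, pr (ψ₁ i (p₁ i) * ψ₂ i (p₂ i)))`, `ψ_j i ∈ Ψ_j χ`, `p_j i ∈ jplusSubmodule`.
* KERNEL (§2, over pv12/pv14's model, by name): for `p` in the `J⁺`-piece, its `z`-degree-`n` parts `zPart n p`
  (iii-a) sum to `p` (`sum_zPart`), (iii-b) stay in the `J⁺`-piece (`zPart_mem`, from `Fock.inJplus_support` /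
  `Fock.monomial_inJplus`), (iii-c) are eigenvectors of the central `U(1)_V`-element `diagK 1 1 d` with eigenvalue
  `d̄ ^ n` (`fockRep_diagK_one_zPart`, from pv14-g3 `fockRep_diagK_monomial` and `|a| = e + 1`), (iii-d) occur only for
  `n ≥ 1` (`one_le_zdeg`) — this IS the `K`-type list "`n ≥ 1`" of l. 364–366 — and (iv) the `n = 1` part is the
  harmonic-plane vector `x₁ z₁ + x₂ z₂`, `x_a = coeff_{z_a} p` (`zPart_one_eq_zLin`) — "lowest `K_{ι₁}`-type `𝔭₊`",
  so that `ψ (zPart 1 p) = formOf ψ x` IS a component of the canonical theta one-form; `formOf ψ` is a FORM in pv02's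
  sense (`isForm_formOf`, from pv14-g3 `zLin_equivariant`).
* §4 `N19g_core_of_fockBridge : QautFockBridge T V c D k l → N19g_core T V c D k l` — the join being pv02's landed
  `Qaut.pr_mul_eq_zero_of_weights` (`U(1)`-count: `d̄^{n₁} d̄^{n₂} ≠ d̄² = det 𝔭₊(k₀)` unless `n₁ = n₂ = 1`) and
  `Qaut.pr_mul_mem_span_wedge` (wedge combination), EXACTLY ll. 367–372; `nonempty_qautBridge_of_fockBridge` (the
  landed record follows, via pv08-g2's `nonempty_qautBridge_iff`); `open_thetaReal34_of_fockBridges : … → T.Open_thetaReal34`.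

Net effect on the S5 record: sentences (iii) and (iv) leave the dictionary — they are theorems about the model PerL
specifies (MODEL CAVEAT of `P43_KTypesFock`: that `fockRep`/`Jplus` IS `ω_{ι₁}` restricted to `K_{ι₁}` on the
`χ̄'`-isotypic part is the dictionary (F1)/(F2), carried here by the single field `equiv`).  The same hypothesis SHAPE
(a `K`-equivariant map between the theta space and copies of `Jplus`) discharges pv14-g3's Schur leaves `h₀ h₁` of
N33b (X1) (`P43_KTypesFockJplus.thetaPKilledByPminus_of_U2_Jplus`): ONE (β)+D5 sentence now feeds both N33b and N19g.

STRENGTH (referee-A P1).  `Nonempty (QautFockBridge …) → Nonempty (QautBridge …) ↔ N19g_core …` (this file + pv08-g2).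
The converse (conservativity of the sharper record over the leaf) is NOT proved here; it is expected via pv08-g2's junk
shell `K = Circle × D₄` with `κ (z, g) := (ρF g, z⁻¹)` and theta maps `ψ := u ∘ zLin⁻¹ ∘ zPart 1`, and is recorded as
open in HOME/GAPS.md `## pub-hodgecm-pv08-g4`.

Unit `pub-hodgecm-pv08-g4`, 2026-08-18.  Fully kernel-checked; standard axiom trio.
-/

set_option autoImplicit false

noncomputable section

open MeasureTheory Matrix MvPolynomial
open HodgeCM.Prior.Perl34File
open HodgeCM.PerL34.Qaut
open HodgeCM.PerL34.P43KTypesU2 (mat mat_mul_star pPlus pPlus_apply fockRep fockRep_apply diagK mat_diagK diagK_snd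
  fockRep_diagK_monomial jplusSubmodule mem_jplusSubmodule Jplus Jplus_apply_coe zLin zLin_apply zLin_equivariant
  zLin_mem_jplus coeff_zLin)

namespace HodgeCM
namespace PerL34
namespace QautFock

/-! ## §1. `𝔭₊` on `K_{ι₁} = U(2) × U(1)` as a matrix-valued homomorphism (pv14-g3's `pPlus`, repackaged for pv02's shell) -/

/-- `𝔭₊ (A, d) = d̄ • A` — the matrix of pv14-g3's `pPlus (A,d) v = d̄ • A v` in the standard (weight) basis. -/
def pPlusMat : P43KTypesU2.K →* Matrix (Fin 2) (Fin 2) ℂ where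
  toFun x := star (x.2 : ℂ) • mat x
  map_one' := by
    simp [mat]
  map_mul' x y := by
    simp only [mat, Prod.fst_mul, Prod.snd_mul, Submonoid.coe_mul, star_mul', Matrix.smul_mul, Matrix.mul_smul,
      smul_smul]
    rw [mul_comm (star (x.2 : ℂ)) (star (y.2 : ℂ))]

/-- (Ported verbatim from the HodgeCMPerL package; no docstring in the source.) -/
theorem pPlusMat_apply (x : P43KTypesU2.K) : pPlusMat x = star (x.2 : ℂ) • mat x := rfl

/-- `pPlusMat x *ᵥ v = pPlus x v`. -/
theorem pPlusMat_mulVec (x : P43KTypesU2.K) (v : Fin 2 → ℂ) : pPlusMat x *ᵥ v = pPlus x v := by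
  rw [pPlus_apply, pPlusMat_apply, Matrix.smul_mulVec]

/-- (Ported verbatim from the HodgeCMPerL package; no docstring in the source.) -/
theorem continuous_pPlusMat : Continuous fun x : P43KTypesU2.K => pPlusMat x :=
  ((continuous_subtype_val.comp continuous_snd).star).smul (continuous_subtype_val.comp continuous_fst)

/-- (Ported verbatim from the HodgeCMPerL package; no docstring in the source.) -/
theorem isUnit_star_coe (d : unitary ℂ) : IsUnit (star (d : ℂ)) :=
  IsUnit.of_mul_eq_one (d : ℂ) (Unitary.star_mul_self_of_mem d.prop)

/-- (Ported verbatim from the HodgeCMPerL package; no docstring in the source.) -/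
theorem star_coe_ne_zero (d : unitary ℂ) : star (d : ℂ) ≠ 0 := (isUnit_star_coe d).ne_zero

/-- (Ported verbatim from the HodgeCMPerL package; no docstring in the source.) -/
theorem isUnit_det_mat (x : P43KTypesU2.K) : IsUnit (mat x).det :=
  IsUnit.of_mul_eq_one (star (mat x)).det (by rw [← Matrix.det_mul, mat_mul_star, Matrix.det_one])

/-- (Ported verbatim from the HodgeCMPerL package; no docstring in the source.) -/
theorem isUnit_det_pPlusMat (x : P43KTypesU2.K) : IsUnit (pPlusMat x).det := by
  rw [pPlusMat_apply, Matrix.det_smul, Fintype.card_fin]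
  exact ((isUnit_star_coe x.2).pow 2).mul (isUnit_det_mat x)

/-- On the central `U(1)_V`: `𝔭₊ (1₂, d) = d̄ • 1`. -/
theorem pPlusMat_diagK_one (d : unitary ℂ) : pPlusMat (diagK 1 1 d) = star (d : ℂ) • (1 : Matrix (Fin 2) (Fin 2) ℂ) := by
  rw [pPlusMat_apply, diagK_snd, mat_diagK]
  congr 1
  ext i j
  fin_cases i <;> fin_cases j <;> simp [Matrix.diagonal]

/-- (Ported verbatim from the HodgeCMPerL package; no docstring in the source.) -/
theorem det_pPlusMat_diagK_one (d : unitary ℂ) : (pPlusMat (diagK 1 1 d)).det = star (d : ℂ) ^ 2 := by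
  rw [pPlusMat_diagK_one, Matrix.det_smul, Matrix.det_one, mul_one, Fintype.card_fin]

/-- `d̄ ^ m ≠ 1` for `m ≥ 1` when `d` has infinite order. -/
theorem star_pow_ne_one {d : unitary ℂ} (hd : ∀ m : ℕ, 1 ≤ m → (d : ℂ) ^ m ≠ 1) (m : ℕ) (hm : 1 ≤ m) :
    star (d : ℂ) ^ m ≠ 1 := by
  intro h
  apply hd m hm
  have := congrArg star h
  rwa [star_pow, star_star, star_one] at this

/-- The `U(1)`-weight count, arithmetic half (l. 368–370): for `n₁, n₂ ≥ 1` not both `1`, `ξ^{n₁} ξ^{n₂} ≠ ξ²` for `ξ` of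
infinite order. -/
theorem pow_mul_pow_ne_sq {ξ : ℂ} (hξ : ξ ≠ 0) (hξ1 : ∀ m : ℕ, 1 ≤ m → ξ ^ m ≠ 1) {n₁ n₂ : ℕ} (h₁ : 1 ≤ n₁)
    (h₂ : 1 ≤ n₂) (h : ¬(n₁ = 1 ∧ n₂ = 1)) : ξ ^ n₁ * ξ ^ n₂ ≠ ξ ^ 2 := by
  rw [← pow_add]
  have h3 : 2 + 1 ≤ n₁ + n₂ := by omega
  obtain ⟨m, hm⟩ := Nat.exists_eq_add_of_le h3
  intro heq
  have hm' : n₁ + n₂ = 2 + (m + 1) := by omega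
  rw [hm', pow_add] at heq
  have hone : ξ ^ (m + 1) = 1 :=
    mul_left_cancel₀ (pow_ne_zero 2 hξ) (heq.trans (mul_one (ξ ^ 2)).symm)
  exact hξ1 (m + 1) (by omega) hone

/-! ## §2. KERNEL `K`-type bookkeeping in the `J⁺`-piece of `ℂ[z₁,z₂,w]` -/

/-- the total `z`-degree `|a| = a₁ + a₂` of an exponent vector `(a₁, a₂; e)`. -/
def zdeg (m : Fock.HarmVar →₀ ℕ) : ℕ := m (Sum.inl 0) + m (Sum.inl 1)

/-- the `z`-degree-`n` part of a polynomial (its `n`-th `K_V`-type component when it lies in the `J⁺`-piece). -/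
def zPart (n : ℕ) (p : Fock.HarmModel) : Fock.HarmModel :=
  ∑ m ∈ p.support with zdeg m = n, monomial m (coeff m p)

/-- the set of `z`-degrees occurring in `p`. -/
def zDegs (p : Fock.HarmModel) : Finset ℕ := p.support.image zdeg

/-- (iii-a) `p` is the sum of its `z`-degree parts. -/
theorem sum_zPart (p : Fock.HarmModel) : ∑ n ∈ zDegs p, zPart n p = p := by
  unfold zPart zDegs
  rw [Finset.sum_fiberwise_of_maps_to (fun m hm => Finset.mem_image_of_mem zdeg hm)]
  exact p.as_sum.symm

/-- In the `J⁺`-piece every monomial `z^a w^e` has `|a| = e + 1` (pv12 `Fock.inJplus_support`). -/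
theorem zdeg_eq_of_mem {p : Fock.HarmModel} (hp : p ∈ jplusSubmodule) {m : Fock.HarmVar →₀ ℕ}
    (hm : m ∈ p.support) : zdeg m = m (Sum.inr ()) + 1 :=
  Fock.inJplus_support (mem_jplusSubmodule.mp hp) hm

/-- (iii-d) **the `K`-type list "`n ≥ 1`"** (l. 364): only `z`-degrees `≥ 1` occur in the `J⁺`-piece. -/
theorem one_le_of_mem_zDegs {p : Fock.HarmModel} (hp : p ∈ jplusSubmodule) {n : ℕ} (hn : n ∈ zDegs p) : 1 ≤ n := by
  obtain ⟨m, hm, rfl⟩ := Finset.mem_image.mp hn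
  rw [zdeg_eq_of_mem hp hm]
  omega

/-- (iii-b) the `z`-degree parts stay in the `J⁺`-piece. -/
theorem zPart_mem {p : Fock.HarmModel} (hp : p ∈ jplusSubmodule) (n : ℕ) : zPart n p ∈ jplusSubmodule := by
  refine Submodule.sum_mem _ fun m hm => ?_
  rw [mem_jplusSubmodule]
  exact Fock.monomial_inJplus m (zdeg_eq_of_mem hp (Finset.mem_filter.mp hm).1) _

/-- (iii-c) **the central `U(1)_V` acts on the `n`-th part by `d̄ ^ n`** (pv14-g3 `fockRep_diagK_monomial`: on `z^a w^e`
the element `(1₂, d)` acts by `d̄ · d̄^e = d̄^{e+1} = d̄^{|a|}`). -/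
theorem fockRep_diagK_one_zPart {p : Fock.HarmModel} (hp : p ∈ jplusSubmodule) (d : unitary ℂ) (n : ℕ) :
    fockRep (diagK 1 1 d) (zPart n p) = star (d : ℂ) ^ n • zPart n p := by
  unfold zPart
  rw [map_sum, Finset.smul_sum]
  refine Finset.sum_congr rfl fun m hm => ?_
  obtain ⟨hms, hmn⟩ := Finset.mem_filter.mp hm
  rw [fockRep_diagK_monomial]
  congr 1
  have hdeg := zdeg_eq_of_mem hp hms
  rw [← hmn, hdeg, OneMemClass.coe_one, one_pow, one_pow, one_mul, one_mul, pow_succ']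

/-- An exponent vector of `z`-degree `1` and `w`-degree `0` is `z₁` or `z₂`. -/
theorem eq_single_of_zdeg_one {m : Fock.HarmVar →₀ ℕ} (h1 : zdeg m = 1) (hw : m (Sum.inr ()) = 0) :
    ∃ a : Fin 2, m = Finsupp.single (Sum.inl a) 1 := by
  unfold zdeg at h1
  have hcases : (m (Sum.inl 0) = 1 ∧ m (Sum.inl 1) = 0) ∨ (m (Sum.inl 0) = 0 ∧ m (Sum.inl 1) = 1) := by omega
  rcases hcases with ⟨h0, h1'⟩ | ⟨h0, h1'⟩
  · refine ⟨0, Finsupp.ext fun v => ?_⟩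
    rcases v with a | u
    · fin_cases a <;> simp [h0, h1']
    · rw [Finsupp.single_eq_of_ne (by simp)]
      cases u; exact hw
  · refine ⟨1, Finsupp.ext fun v => ?_⟩
    rcases v with a | u
    · fin_cases a <;> simp [h0, h1']
    · rw [Finsupp.single_eq_of_ne (by simp)]
      cases u; exact hw

/-- (Ported verbatim from the HodgeCMPerL package; no docstring in the source.) -/
theorem zdeg_single (a : Fin 2) : zdeg (Finsupp.single (Sum.inl a) 1) = 1 := by
  unfold zdeg
  fin_cases a <;> simp

/-- coefficients of a `z`-degree part -/
theorem coeff_zPart (n : ℕ) (p : Fock.HarmModel) (m : Fock.HarmVar →₀ ℕ) :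
    coeff m (zPart n p) = if zdeg m = n then coeff m p else 0 := by
  classical
  unfold zPart
  rw [coeff_sum]
  simp only [coeff_monomial]
  rw [Finset.sum_ite_eq' (p.support.filter fun m => zdeg m = n) m (fun x => coeff x p)]
  simp only [Finset.mem_filter, MvPolynomial.mem_support_iff, ne_eq]
  by_cases hn : zdeg m = n
  · by_cases hc : coeff m p = 0
    · simp [hn, hc]
    · simp [hn, hc]
  · simp [hn]

/-- coefficients of a harmonic-plane vector -/
theorem coeff_zLin' (v : Fin 2 → ℂ) (m : Fock.HarmVar →₀ ℕ) :
    coeff m (zLin v) = ∑ a : Fin 2, if Finsupp.single (Sum.inl a) 1 = m then v a else 0 := by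
  classical
  rw [zLin_apply, coeff_sum]
  refine Finset.sum_congr rfl fun a _ => ?_
  rw [coeff_smul, coeff_X, smul_eq_mul, mul_ite, mul_one, mul_zero]

/-- (iv) **lowest `K_{ι₁}`-type `𝔭₊`**: the `z`-degree-`1` part of a `J⁺`-vector is the harmonic-plane vector
`Σ_a (coeff_{z_a} p) z_a` (l. 370–371 "both factors lie in the lowest `K_∞`-type `𝔭₊ = V⁺ ⊗ (V⁻)^{-1}`"). -/
theorem zPart_one_eq_zLin {p : Fock.HarmModel} (hp : p ∈ jplusSubmodule) :
    zPart 1 p = zLin fun a => coeff (Finsupp.single (Sum.inl a) 1) p := by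
  classical
  refine MvPolynomial.ext _ _ fun m => ?_
  rw [coeff_zPart, coeff_zLin']
  by_cases h1 : zdeg m = 1
  · rw [if_pos h1]
    by_cases hm : m ∈ p.support
    · have hw : m (Sum.inr ()) = 0 := by have := zdeg_eq_of_mem hp hm; omega
      obtain ⟨a, rfl⟩ := eq_single_of_zdeg_one h1 hw
      fin_cases a <;> simp [Finsupp.single_eq_single_iff]
    · have hc : coeff m p = 0 := by rwa [MvPolynomial.mem_support_iff, not_not] at hm
      rw [hc]
      symm
      refine Finset.sum_eq_zero fun a _ => ?_
      split_ifs with ha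
      · rw [← ha] at hc; exact hc
      · rfl
  · rw [if_neg h1]
    symm
    refine Finset.sum_eq_zero fun a _ => ?_
    rw [if_neg]
    rintro rfl
    exact h1 (zdeg_single a)

/-- The harmonic plane `𝔭₊ ↪ J⁺`, `x ↦ x₁ z₁ + x₂ z₂`, as a map into the `J⁺`-piece (pv14-g3 `zLin`, `zLin_mem_jplus`). -/
def zLinJ : (Fin 2 → ℂ) →ₗ[ℂ] jplusSubmodule := LinearMap.codRestrict jplusSubmodule zLin zLin_mem_jplus

/-- (Ported verbatim from the HodgeCMPerL package; no docstring in the source.) -/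
@[simp] theorem zLinJ_coe (x : Fin 2 → ℂ) : ((zLinJ x : jplusSubmodule) : Fock.HarmModel) = zLin x := rfl

/-- `K`-equivariance of `𝔭₊ ↪ J⁺` (pv14-g3 `zLin_equivariant`). -/
theorem zLinJ_equivariant (y : P43KTypesU2.K) (x : Fin 2 → ℂ) : zLinJ (pPlus y x) = Jplus y (zLinJ x) :=
  Subtype.ext (by rw [zLinJ_coe, Jplus_apply_coe, zLinJ_coe, zLin_equivariant])

/-- **The canonical one-form of a theta map** `ψ : J⁺ → C`: `x ↦ ψ (x₁ z₁ + x₂ z₂)` (its components `ψ z₁, ψ z₂` are the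
two components of the holomorphic theta one-form `u_f`, l. 371 / ll. 650–652). -/
def formOf {C : Type*} [AddCommGroup C] [Module ℂ C] (ψ : jplusSubmodule →ₗ[ℂ] C) : (Fin 2 → ℂ) →ₗ[ℂ] C :=
  ψ ∘ₗ zLinJ

/-- (Ported verbatim from the HodgeCMPerL package; no docstring in the source.) -/
theorem formOf_apply {C : Type*} [AddCommGroup C] [Module ℂ C] (ψ : jplusSubmodule →ₗ[ℂ] C) (x : Fin 2 → ℂ) :
    formOf ψ x = ψ (zLinJ x) := rfl

/-- the `z`-degree parts as elements of the `J⁺`-piece -/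
def zPartJ (n : ℕ) (p : jplusSubmodule) : jplusSubmodule := ⟨zPart n p, zPart_mem p.2 n⟩

/-- (Ported verbatim from the HodgeCMPerL package; no docstring in the source.) -/
@[simp] theorem zPartJ_coe (n : ℕ) (p : jplusSubmodule) : ((zPartJ n p : jplusSubmodule) : Fock.HarmModel) = zPart n p :=
  rfl

/-- (Ported verbatim from the HodgeCMPerL package; no docstring in the source.) -/
theorem sum_zPartJ (p : jplusSubmodule) : ∑ n ∈ zDegs (p : Fock.HarmModel), zPartJ n p = p :=
  Subtype.ext (by rw [Submodule.coe_sum]; simp only [zPartJ_coe]; exact sum_zPart _)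

/-- (Ported verbatim from the HodgeCMPerL package; no docstring in the source.) -/
theorem Jplus_diagK_one_zPartJ (d : unitary ℂ) (n : ℕ) (p : jplusSubmodule) :
    Jplus (diagK 1 1 d) (zPartJ n p) = star (d : ℂ) ^ n • zPartJ n p :=
  Subtype.ext (by rw [Jplus_apply_coe, zPartJ_coe, Submodule.coe_smul, zPartJ_coe, fockRep_diagK_one_zPart p.2])

/-- (Ported verbatim from the HodgeCMPerL package; no docstring in the source.) -/
theorem zPartJ_one_eq (p : jplusSubmodule) :
    zPartJ 1 p = zLinJ fun a => coeff (Finsupp.single (Sum.inl a) 1) (p : Fock.HarmModel) :=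
  Subtype.ext (by rw [zPartJ_coe, zLinJ_coe, zPart_one_eq_zLin p.2])

/-! ## §3. The sharpened S5 record -/

variable {U : Universe} (T : U.ThetaModel)
variable {L : CMField} {ι₁ : L →+* ℂ} (V : HermSpace3 L ι₁) (c : SeesawCtx L)
variable (D : Perl34.TorusData (T.core V c)) (k l : Fin 4)


-- port_pkg: scope closed for this part
end QautFock
end PerL34
end HodgeCM
end
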